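import Literature.Probability.Percolation.ConditionalPositiveAssociationProofs
import Literature.Probability.Percolation.KozmaNitzanClusterProperty
import HarnessLib

/-!
# Quantitative BHK Thm 1.3: an explicit floor from any monotone majorant (the «separation floor», abstract form)

Support file (`--supports stmt-CriticalPhenomena-4575`), prover seat `prim-rate-mine-2` (lane prim-rate, constants-miner (c), BENCH row
M2-R10, abstract form; `run/shared/lean/prim/prim-rate/prim-rate-mine-2/CANDIDATES.md` §gen-2, PROOFS.md §P10).  No definitions, no named
facts, no sorries; standard axioms.

van den Berg–Häggström–Kahn's Theorem 1.3 (tree: `BHK2006_clusterConditionalPositiveAssociation_holds`) says that the open cluster `C_s` is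
positively associated under `ν = μ(· | s ↮ X)`: `Cov_ν(F(C_s), G̃(C_s)) ≥ 0` for increasing `F, G̃`.  The one-line upgrade recorded here: if `G`
is ANY function with `F·G̃ = F·G` pointwise (typically `F = 1_B` for an increasing event `B` and `G̃` an increasing majorant of `G` that agrees
with `G` on `B`), then

  `(∫_D F(C_s)) · (∫_D G̃(C_s)) ≤ μ(D) · ∫_D F(C_s) G(C_s)`,   i.e.   `Cov_ν(F, G) ≥ E_ν[F] · (E_ν[G̃] − E_ν[G])`

— an EXPLICIT lower bound for the conditional covariance, with all the combinatorics moved into the choice of the majorant `G̃` (the optimal one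
is the monotone hull of `G` along `B`; for connection events it is a vertex-SEPARATION indicator, whence the lane's «separation floor»
`Cov_ν(1{a ∈ C_s}, 1{b ∈ C_s}) ≥ ν(a ∈ C_s)·ν(a, b ∉ C_s, b separates C_s from a)` and, through BHK's display (10), the first explicit floor for the
two-cluster repulsion of their Theorem 1.4).  Both the edge-cluster form (BHK's `C_s` = `openEdgeCluster`) and the vertex-cluster form
(`openCluster`, the vocabulary of the CSH files) are given.
[cite: VandenbergHaggstromKahn2005, Thm. 1.3 (p. 6)]
-/

noncomputable section

namespace Summit.CriticalPhenomena.PercolationContinuityZ3.Theorems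

open MeasureTheory Set Literature.Probability.LatticeModels Literature.Probability.Percolation
open scoped Classical

namespace QuantBHK

universe v

variable {V : Type v} [Fintype V]

/-- **Quantitative BHK 1.3 from a monotone majorant (edge-cluster form).**  For `D = {s ↮ X}`, `F, G̃` increasing functions of the open
edge cluster and `G` any function with `F C * G̃ C = F C * G C` for all `C`:
`(∫_D F(C_s) dμ)·(∫_D G̃(C_s) dμ) ≤ μ(D)·∫_D F(C_s)·G(C_s) dμ`.  (BHK 1.3 for `(F, G̃)`, then `F·G̃ = F·G`.)
[cite: VandenbergHaggstromKahn2005, Thm. 1.3 (p. 6)] -/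
theorem setIntegral_mul_setIntegral_majorant_le (w : Sym2 V → unitInterval) (s : V) (X : Set V) (hs : s ∉ X)
    (F G Gt : Set (Sym2 V) → ℝ) (hF : Monotone F) (hGt : Monotone Gt) (hFG : ∀ C, F C * Gt C = F C * G C) :
    (∫ ω in {ω : BondConfig V | ∀ x ∈ X, ¬ (openGraph ω).Reachable s x},
        F (openEdgeCluster ω s) ∂(prodBernoulli w)) *
      (∫ ω in {ω : BondConfig V | ∀ x ∈ X, ¬ (openGraph ω).Reachable s x},
        Gt (openEdgeCluster ω s) ∂(prodBernoulli w)) ≤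
    (prodBernoulli w).real {ω : BondConfig V | ∀ x ∈ X, ¬ (openGraph ω).Reachable s x} *
      ∫ ω in {ω : BondConfig V | ∀ x ∈ X, ¬ (openGraph ω).Reachable s x},
        F (openEdgeCluster ω s) * G (openEdgeCluster ω s) ∂(prodBernoulli w) := by
  have key := BHK2006_clusterConditionalPositiveAssociation_holds V w s X F Gt hF hGt hs
  have hfg : (fun ω : BondConfig V => F (openEdgeCluster ω s) * Gt (openEdgeCluster ω s)) =
      fun ω => F (openEdgeCluster ω s) * G (openEdgeCluster ω s) := by
    funext ω; exact hFG _
  rw [hfg] at key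
  exact key

/-- **The explicit floor, edge-cluster form.**  Same hypotheses: the conditional covariance of `F(C_s)` and `G(C_s)` given `{s ↮ X}` is
at least `E_ν[F]·(E_ν[G̃] − E_ν[G])`, denominator-free:
`(∫_D F)(∫_D G̃ − ∫_D G) ≤ μ(D)∫_D F G − (∫_D F)(∫_D G)`. [cite: VandenbergHaggstromKahn2005, Thm. 1.3 (p. 6)] -/
theorem condCov_ge_majorant_gap (w : Sym2 V → unitInterval) (s : V) (X : Set V) (hs : s ∉ X)
    (F G Gt : Set (Sym2 V) → ℝ) (hF : Monotone F) (hGt : Monotone Gt) (hFG : ∀ C, F C * Gt C = F C * G C) :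
    (∫ ω in {ω : BondConfig V | ∀ x ∈ X, ¬ (openGraph ω).Reachable s x},
        F (openEdgeCluster ω s) ∂(prodBernoulli w)) *
      ((∫ ω in {ω : BondConfig V | ∀ x ∈ X, ¬ (openGraph ω).Reachable s x},
          Gt (openEdgeCluster ω s) ∂(prodBernoulli w)) -
        ∫ ω in {ω : BondConfig V | ∀ x ∈ X, ¬ (openGraph ω).Reachable s x},
          G (openEdgeCluster ω s) ∂(prodBernoulli w)) ≤
    (prodBernoulli w).real {ω : BondConfig V | ∀ x ∈ X, ¬ (openGraph ω).Reachable s x} *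
        (∫ ω in {ω : BondConfig V | ∀ x ∈ X, ¬ (openGraph ω).Reachable s x},
          F (openEdgeCluster ω s) * G (openEdgeCluster ω s) ∂(prodBernoulli w)) -
      (∫ ω in {ω : BondConfig V | ∀ x ∈ X, ¬ (openGraph ω).Reachable s x},
          F (openEdgeCluster ω s) ∂(prodBernoulli w)) *
        ∫ ω in {ω : BondConfig V | ∀ x ∈ X, ¬ (openGraph ω).Reachable s x},
          G (openEdgeCluster ω s) ∂(prodBernoulli w) := by
  have key := setIntegral_mul_setIntegral_majorant_le w s X hs F G Gt hF hGt hFG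
  nlinarith [key]

omit [Fintype V] in
/-- The vertex span of an edge set seen from `s` (`= openCluster ω s` on `C = openEdgeCluster ω s`,
`KNPreFKG.openCluster_eq_setOf_openEdgeCluster`). [cite: VandenbergHaggstromKahn2005, §1 p. 3] -/
theorem monotone_vertexSpan (s : V) : Monotone fun C : Set (Sym2 V) => ({a : V | a = s ∨ ∃ e ∈ C, a ∈ e} : Set V) := by
  intro C C' hCC' a ha
  rcases ha with h | ⟨e, he, hae⟩
  · exact Or.inl h
  · exact Or.inr ⟨e, hCC' he, hae⟩

/-- **Quantitative BHK 1.3 from a monotone majorant, vertex-cluster form** (the vocabulary of the CSH files: `openCluster ω s : Set V`).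
For `D = {s ↮ X}`, `Fv, G̃v : Set V → ℝ` increasing and `Gv` any function with `Fv S * G̃v S = Fv S * Gv S` for all `S`:
`(∫_D Fv(C_s))·(∫_D G̃v(C_s) − ∫_D Gv(C_s)) ≤ μ(D)∫_D Fv(C_s)Gv(C_s) − (∫_D Fv(C_s))(∫_D Gv(C_s))`, i.e.
`Cov_ν(Fv(C_s), Gv(C_s)) ≥ E_ν[Fv(C_s)]·(E_ν[G̃v(C_s)] − E_ν[Gv(C_s)])`. [cite: VandenbergHaggstromKahn2005, Thm. 1.3 (p. 6)] -/
theorem condCov_openCluster_ge_majorant_gap (w : Sym2 V → unitInterval) (s : V) (X : Set V) (hs : s ∉ X)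
    (Fv Gv Gtv : Set V → ℝ) (hF : ∀ S S' : Set V, S ⊆ S' → Fv S ≤ Fv S') (hGt : ∀ S S' : Set V, S ⊆ S' → Gtv S ≤ Gtv S')
    (hFG : ∀ S, Fv S * Gtv S = Fv S * Gv S) :
    (∫ ω in {ω : BondConfig V | ∀ x ∈ X, ¬ (openGraph ω).Reachable s x}, Fv (openCluster ω s) ∂(prodBernoulli w)) *
      ((∫ ω in {ω : BondConfig V | ∀ x ∈ X, ¬ (openGraph ω).Reachable s x}, Gtv (openCluster ω s) ∂(prodBernoulli w)) -
        ∫ ω in {ω : BondConfig V | ∀ x ∈ X, ¬ (openGraph ω).Reachable s x}, Gv (openCluster ω s) ∂(prodBernoulli w)) ≤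
    (prodBernoulli w).real {ω : BondConfig V | ∀ x ∈ X, ¬ (openGraph ω).Reachable s x} *
        (∫ ω in {ω : BondConfig V | ∀ x ∈ X, ¬ (openGraph ω).Reachable s x},
          Fv (openCluster ω s) * Gv (openCluster ω s) ∂(prodBernoulli w)) -
      (∫ ω in {ω : BondConfig V | ∀ x ∈ X, ¬ (openGraph ω).Reachable s x}, Fv (openCluster ω s) ∂(prodBernoulli w)) *
        ∫ ω in {ω : BondConfig V | ∀ x ∈ X, ¬ (openGraph ω).Reachable s x}, Gv (openCluster ω s) ∂(prodBernoulli w) := by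
  set vs : Set (Sym2 V) → Set V := fun C => {a : V | a = s ∨ ∃ e ∈ C, a ∈ e} with hvs
  have hvsC : ∀ ω : BondConfig V, vs (openEdgeCluster ω s) = openCluster ω s := fun ω => by
    rw [KNPreFKG.openCluster_eq_setOf_openEdgeCluster]
  have hmono := monotone_vertexSpan (V := V) s
  have key := condCov_ge_majorant_gap w s X hs (fun C => Fv (vs C)) (fun C => Gv (vs C)) (fun C => Gtv (vs C))
    (fun C C' h => hF _ _ (hmono h)) (fun C C' h => hGt _ _ (hmono h)) (fun C => hFG (vs C))
  simp only [hvsC] at key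
  exact key

/-- **The separation floor for an increasing EVENT, vertex-cluster form.**  `B` an upper family of vertex sets (increasing cluster event),
`Gv` any function, `G̃v` increasing with `G̃v = Gv` on `B`: writing `D = {s ↮ X}` and `DB = D ∩ {C_s ∈ B}`,
`μ(DB)·(∫_D G̃v(C_s) − ∫_D Gv(C_s)) ≤ μ(D)·∫_{DB} Gv(C_s) − μ(DB)·∫_D Gv(C_s)`, i.e.
`Cov_ν(1_B(C_s), Gv(C_s)) ≥ ν(C_s ∈ B)·E_ν[G̃v(C_s) − Gv(C_s)]` (lane PROOFS §P10; with the monotone hull of `Gv` along `B` as `G̃v` this is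
the «separation floor» of BENCH row M2-R10). [cite: VandenbergHaggstromKahn2005, Thm. 1.3 (p. 6)] -/
theorem condCov_indicator_openCluster_ge_majorant_gap (w : Sym2 V → unitInterval) (s : V) (X : Set V) (hs : s ∉ X)
    (B : Set (Set V)) (hB : IsUpperSet B) (Gv Gtv : Set V → ℝ) (hGt : ∀ S S' : Set V, S ⊆ S' → Gtv S ≤ Gtv S')
    (hagree : ∀ S ∈ B, Gtv S = Gv S) :
    (prodBernoulli w).real ({ω : BondConfig V | ∀ x ∈ X, ¬ (openGraph ω).Reachable s x} ∩ {ω | openCluster ω s ∈ B}) *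
      ((∫ ω in {ω : BondConfig V | ∀ x ∈ X, ¬ (openGraph ω).Reachable s x}, Gtv (openCluster ω s) ∂(prodBernoulli w)) -
        ∫ ω in {ω : BondConfig V | ∀ x ∈ X, ¬ (openGraph ω).Reachable s x}, Gv (openCluster ω s) ∂(prodBernoulli w)) ≤
    (prodBernoulli w).real {ω : BondConfig V | ∀ x ∈ X, ¬ (openGraph ω).Reachable s x} *
        (∫ ω in {ω : BondConfig V | ∀ x ∈ X, ¬ (openGraph ω).Reachable s x} ∩ {ω | openCluster ω s ∈ B},
          Gv (openCluster ω s) ∂(prodBernoulli w)) -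
      (prodBernoulli w).real ({ω : BondConfig V | ∀ x ∈ X, ¬ (openGraph ω).Reachable s x} ∩ {ω | openCluster ω s ∈ B}) *
        ∫ ω in {ω : BondConfig V | ∀ x ∈ X, ¬ (openGraph ω).Reachable s x}, Gv (openCluster ω s) ∂(prodBernoulli w) := by
  set μ := prodBernoulli w with hμ
  set D : Set (BondConfig V) := {ω : BondConfig V | ∀ x ∈ X, ¬ (openGraph ω).Reachable s x} with hD
  set EB : Set (BondConfig V) := {ω | openCluster ω s ∈ B} with hEB
  have hmeas : ∀ S : Set (BondConfig V), MeasurableSet S := fun _ => MeasurableSet.of_discrete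
  -- the indicator functional
  set Fv : Set V → ℝ := fun S => if S ∈ B then 1 else 0 with hFv
  have hFmono : ∀ S S' : Set V, S ⊆ S' → Fv S ≤ Fv S' := by
    intro S S' h
    simp only [hFv]
    by_cases hS : S ∈ B
    · rw [if_pos hS, if_pos (hB h hS)]
    · rw [if_neg hS]; split_ifs <;> norm_num
  have hFG : ∀ S, Fv S * Gtv S = Fv S * Gv S := by
    intro S
    simp only [hFv]
    by_cases hS : S ∈ B
    · rw [if_pos hS, hagree S hS]
    · rw [if_neg hS, zero_mul, zero_mul]
  have key := condCov_openCluster_ge_majorant_gap w s X hs Fv Gv Gtv hFmono hGt hFG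
  -- identify the `Fv`-integrals with measures / restricted integrals
  have hind : ∀ ω : BondConfig V, Fv (openCluster ω s) = EB.indicator (fun _ => (1 : ℝ)) ω := by
    intro ω
    simp only [hFv, hEB, Set.indicator, Set.mem_setOf_eq]
  have h1 : ∫ ω in D, Fv (openCluster ω s) ∂μ = μ.real (D ∩ EB) := by
    simp_rw [hind]
    rw [integral_indicator (hmeas EB), Measure.restrict_restrict (hmeas EB), integral_const, smul_eq_mul, mul_one,
      Set.inter_comm, measureReal_restrict_apply_univ]
  have h2 : ∫ ω in D, Fv (openCluster ω s) * Gv (openCluster ω s) ∂μ = ∫ ω in D ∩ EB, Gv (openCluster ω s) ∂μ := by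
    have : (fun ω : BondConfig V => Fv (openCluster ω s) * Gv (openCluster ω s)) =
        EB.indicator (fun ω => Gv (openCluster ω s)) := by
      funext ω
      rw [hind]
      by_cases hω : ω ∈ EB
      · rw [Set.indicator_of_mem hω, Set.indicator_of_mem hω, one_mul]
      · rw [Set.indicator_of_notMem hω, Set.indicator_of_notMem hω, zero_mul]
    rw [this, integral_indicator (hmeas EB), Measure.restrict_restrict (hmeas EB), Set.inter_comm]
  rw [h1, h2] at key
  exact key

end QuantBHK

end Summit.CriticalPhenomena.PercolationContinuityZ3.Theorems
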